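import Mathlib
import Literature.MathematicalPhysics.QuantumFieldTheory.Balaban1983to89.B16PostRGeom

/-!
# `Balaban1983to89.B16Stage3Regions` — [Balaban1989LargeFieldI] (1.10)–(1.12) p. 179, (1.73) p. 192 and the UNDEFINED
`Λ~` of [Balaban1989LargeFieldII] p. 375: the depth regions of the 𝐑-operation near the old domain `Ω_{k₀+1}`,
KERNEL-CHECKED as finite set algebra on `ℤᵈ` (cell `GAPS.md` row G-B16-04 (c); answers the ASKs of rows C-adv3-68 / C-adv3-69;
v1.2 §H: the p. 362 localization domain `X₀` vs `Λ`, `Λ~` — rows C-adv3-89 (C2), C-adv3-90 (q), C-b02g26-1)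

CITATION HEADER (lean-in-tree rule 2026-08-18).  Sources: T. Bałaban, *Large field renormalization. I. The basic step of
the 𝐑 operation*, Commun. Math. Phys. **122**, 175–202 (1989) [Balaban1989LargeFieldI] (= [IV], cell paper B15; held
`paper:balaban1989-cmp122-large-field-i`, journal page = PDF page + 174; quotations read AS IMAGES on the x2 renders
`b2b-balaban-ref1/pages/1989-cmp122-large-field-I/…-p003/p005/p016/p017/p018-x2.png`) and *Large field renormalization.
II. Localization, exponentiation, and bounds for the 𝐑 operation*, Commun. Math. Phys. **122**, 355–392 (1989)
[Balaban1989LargeFieldII] (cell paper B16; held `paper:balaban1989-cmp122-large-field-ii`, journal page = PDF page + 354;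
renders `…/1989-cmp122-large-field-II/…-p020/p021-x2.png`).  The layer operation `X~ⁿ` is the sup-metric cube layer of
[Balaban1987RG1] p. 257 as typed in `…B14DomainGeom` (`enl s n X`; unit pv02), with the supplements of `…B16PostRGeom`
(unit b02, gen 3; `box`, `enl_box`).  The margin hypothesis of §F is [Balaban1988Convergent] (= [III], cell paper B14)
(3.5) p. 265 in the typed form of `…B14DomainGeom.omega35_subset_compl_enl`.  The papers are manuscripts UNDER
ADJUDICATION by the audit cell `pub-balaban`: NOTHING printed in them is asserted here; every `theorem` below is finite
set algebra on `ℤᵈ`, proved without `sorry` and without new axioms.  NEW sibling module of unit `b2b-balaban-b02`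
(gen 20); it imports `…B16PostRGeom` (→ `…B14DomainGeom`) and modifies nothing.

THE PRINTED TEXT (verbatim, first-hand).
* [IV] p. 177 [PDF 3]: (i) *"it is contained in a cube of the size 100 MR_k"*; (ii) *"in the preceding N renormalization
  steps no new large field regions were created inside this component, and the previous regions contained in it satisfy
  the condition (i) on the corresponding scales."*; then, as a separate sentence FOLLOWING items (i)–(ii): *"According to
  our rule of construction of the large field regions, for such a component all the regions connected with the last N
  steps are rectangular parallelepipeds."* (v1 carried the last sentence under the label (ii); relabelled in v1.1 — cell
  `GAPS.md` row C-pv02g20-5, DOCFIX D1.)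
* [IV] p. 179 [PDF 5]: *"Let us recall that the domains Ω_j^{~n} are unions of L^{−(k−j)}MR_j-cubes of the lattice T_η.
  Take the smallest positive integer N₀ such, that L^{−N₀+1}MR_{k−N₀+1} = M. … Define
  Z″_k = (Z′_{k−N₀})^{~3} = (Ω^{~5}_{k−N₀+1})ᶜ ∩ Z,  Z″_{k−N₀+1} = (Z′_{k−N₀})^~ = (Ω^{~7}_{k−N₀+1})ᶜ ∩ Z,  (1.10)
  and complete these two sets to a sequence Z″_k, Z″_{k−1}, …, Z″_{k−N₀+2}, Z″_{k−N₀+1} in such a way that the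
  complements of these sets form an admissible sequence of domains based on partitions into M-cubes in the corresponding
  scales. Thus Z″_k, Z″_k∖Z″_{k−1} are unions of M-cubes of the lattice T_η, and Z″ᶜ_k, Z″_{k−1} are separated by one
  layer of M-cubes. Similarly, Z″_{k−1}, Z″_{k−1}∖Z″_{k−2} are unions of L⁻¹M-cubes of this lattice, and Z″ᶜ_{k−1},
  Z″_{k−2} are separated by one layer of L⁻¹M-cubes, and so on. Next, define  Z″_j = (Ω_j^{~5})ᶜ ∩ Z for j = k − N₀,
  k − N₀ − 1, …, k − N + 1 = h + 1,  Z″_j = Z_j for j = h, h − 1, …, 1.  (1.11)  This is the new sequence of the large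
  field regions. We define new domains Ω″_j by  Ω″_j = (Z″ᶜ_j ∩ Z) ∪ (Ω_j ∩ Zᶜ) for j = k, k − 1, …, h + 1,  Ω″_j = Ω_j
  for j = h, h − 1, …, 1.  (1.12)  The sequence {Ω″_j} is an admissible sequence"*.
* [IV] p. 190 [PDF 16], (1.64)(i): the bounds hold *"on (Ω″_m∖Ω″_{m+1}) ∩ X for m = 1, …, j − 1, and on
  (Ω″_j∖Ω_{k₀+1}) ∩ X for m = j"*; (ii) (1.66): *"on (Ω_m∖Ω_{m+1}) ∩ X for m = k₀ + 1, …, j − 1, j"*;  p. 191 [PDF 17]: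
  *"For n = j − h = 0 the above space coincides with the space Ũ^c_k(X, α̃₀, α̃₁). They form a descending sequence for
  increasing n, if β and L₀ satisfy certain conditions, for example if β ≤ 1/4 and L₀² ≤ (1/3)L."*
* [IV] p. 192 [PDF 18]: *"The new large field region Z″_k is given by (1.10), i.e., Z″_k = (Ω^{~5}_{k₀+1})ᶜ ∩ Z, hence
  it is a union of M-cubes, by the definition of the index k₀, and it is a rectangular parallelepiped. Define
  Λ = (Ω^{~4}_{k₀+1})ᶜ ∩ Z.  (1.73)  This domain, obtained by adding one layer of M-cubes to Z″_k, is also a union of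
  M-cubes, and by the condition (i) it is a rectangular parallelepiped contained in a cube of the size 100M. The domain Λ
  plays a fundamental role in the definition of the 𝐑-operation, it is the domain on which we integrate out all field
  variables."* (same page: *"the highest power appearing is k − k₀ = N₀. This number is defined by the equality
  L^{−N₀+1}R_{k−N₀+1} = 1"*).
* B16 p. 374 [PDF 20] (stage 3): *"we take the determining set 𝐁_k(Y₃) = 𝐁(Y₃) ∪ 𝐁_k, and the representation
  U_{k,Λ} = U(𝐁_k(Y₃), M·(U_{k,Λ})) = … (1.63)"*; p. 375 [PDF 21]: *"hence the regularity properties of the configuration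
  (1.63) are almost the same, as the regularity properties of U(𝐁_k(Y₃), (M·(𝐔)⌈_{Λᶜ}, V_Λ^{(A)}(M^k(𝐔)))), which,
  considered on the domain (Λ~)ᶜ, are almost the same as these properties for the configuration U(𝐁_k(Y₃), M·(𝐔))"*,
  *"We obtain the final function of (𝐔, 𝐉), for which the regularity properties on the domain (Λ~)ᶜ are almost the same
  as for the configuration U(𝐁″_k(Y₁), M·(𝐔)). On the domain Λ~ the regularity properties are similar to the properties
  of the configuration U″_k"*, (1.65) *"(𝐔, 𝐉) ∈ Ũ^c_k(Y₄, α̃₀, α̃₁) → U⁰_k(𝐔, 𝐉) ∈ Ũ″^c_k(Y₁, α̃₀, α̃₁)"*, *"Let us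
  recall that the last space above, the space of values for the function U⁰_k, is the space defined by (1.64)–(1.69) [IV]
  for n = N"*, and *"for which the regularity conditions on the crucial domain Ω″_{k₀+1}∖Ω_{k₀+1} are weaker than the
  regularity conditions for the new determining set"*.  B16 does not define `Λ~` separately: under the general
  convention of [I] p. 257 (`X~` = `X` plus one layer of cubes of its partition) it is `Λ` plus one layer of M-cubes — the
  LITERAL reading below with t = 1 — and the READING keeps the layer count `t` a parameter.

* B16 p. 357 [PDF 3]: (1.3) *"It is a minimum of the functional U → A(U), for U: U defined and regular on Z,
  M_{𝐁_k}(U) = M_{𝐁_k(Z)}(Q^{s*}_k V_k) on Z∖Λ"*, (1.4) *"⟨δA, J₀⟩ = 0 for all δA: Q_{𝐁_k(Z)}δA = 0 on Z∖Λ"*;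
  p. 362 [PDF 8]: *"At first we localize the minimizer H″_{1,k,Z}. We construct the generalized random walk expansion for
  it, including Z ∩ Ω″~_{h+1} as one of the localization domains X, see Sect. C [13] for details. Other localization
  domains are the same as in that paper; they are based on the partitions into M₁-cubes in corresponding scales, and they
  intersect the domain (Ω″~_{h+1})ᶜ. The expansion has the form (3.107) [13], where X₀ = Z ∩ Ω″~_{h+1}, and the terms of
  the expansion satisfy (3.108) [13]. We consider them on the domain Ωᶜ_k ∩ Ω″_{h+1}."*; p. 363 [PDF 9]: *"The first term
  is equal to g_k⟨(1 − ζ₁)H″_{1,k,X₀}R(ū₀⁻¹)B, J₀⟩, and the function multiplying J₀ satisfies the condition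
  Q_{𝐁_k(Z)}(1 − ζ₁)H″_{1,k,X₀}R(ū₀⁻¹)B = 0 on Z∖Λ."*; p. 364 [PDF 10]: *"It follows from the definition of the function
  H″_{1,k,X₀}, and from the fact that the support of the field B is contained in Λ. This condition is exactly the same as
  the condition for δA in (1.4), therefore the above term is equal to 0."* (renders `…-p003/p008/p009/p010-x2.png`, read
  AS IMAGES by unit b02, gen 26).  Only the LOCATION of the sets `Z∖Λ`, `X₀` is typed below (§H); nothing about the
  operators `H″_{1,k,·}`, the averaging conditions, or the inference of p. 364 is asserted.

READING (declared, not printed). One lattice `Pt d = ℤᵈ` and ONE cube family of side `s` = the M-cubes of the k-th step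
(`X~ⁿ = enl s n X`); `Ω` = the old domain `Ω_{k₀+1}` (k₀ = k − N₀), `Z` = the large-field region of the 𝐑-operation. By
the printed choice of `N₀` (p. 179; p. 192: `L^{−N₀+1}R_{k−N₀+1} = 1`) the `L^{−(k−j)}MR_j`-cubes of the scale j = k₀+1
are exactly the M-cubes, so the two printed regions of (1.10), the region (1.73) and the enlargements `Ω^{~n}_{k₀+1}` live
in this one family; the COMPLETED intermediate regions `Z″_{k−1}, …, Z″_{k₀+2}` (finer cubes) and the regions (1.11) of
the scales j ≤ k₀ (their own cube families, side `s′` below) enter only as abstract sets with displayed hypotheses. `Λ~`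
is carried under BOTH candidate readings, with the thickening `t` a parameter: LITERAL `lamT s t Ω Z = enl s t Λ` (the [I]
p. 257 convention is t = 1) and PATTERN `lamZ s t Ω Z = (Ω^{~(4−t)})ᶜ ∩ Z` (the shape of (1.10)/(1.73): one more depth
level); `lamT ∩ Z ⊆ lamZ` for every `t ≤ 4` (§C), and §§D–E locate every region under either reading. The margin
hypothesis `enl s 7 Ω ⊆ Ω′` of §F ("`Ω_{k₀+1}` lies at least 7 M-layers inside every older domain") is [III] (3.5) at the
step k₀ → k₀+1 (`…B14DomainGeom.omega35_subset_compl_enl`: `Ω_{k₀+1} ⊆ (Z_{k₀}^{~8})ᶜ`, eight `LMR_{k₀+1}`-layers of the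
k₀-th step = eight M-layers of the k-th step by the definition of N₀ and [III] p. 264 *"compatible with all the previous
partitions"*, as quoted in the header of `…B14DomainGeom`) — derived here from that typed shape (`enl_subset_of_omega35`),
never asserted.

WHAT IS PROVED (all unconditional set algebra unless a hypothesis is displayed; `0 < s` only where layers are composed).
* §A layer cancellation `((Ω~ⁿ)ᶜ)~ᵗ ⊆ (Ω~⁽ⁿ⁻ᵗ⁾)ᶜ` for `t ≤ n` (`enl_compl_enl_subset`); `X~ⁿ` is a union of cubes.
* §B the depth regions `farZ s n Ω Z = (Ω~ⁿ)ᶜ ∩ Z`: `Z″_k = farZ 5`, `Z″_{k₀+1} = farZ 7` ((1.10)), `Λ = farZ 4` ((1.73));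
  the tower `Z″_{k₀+1} ⊆ Z″_k ⊆ Λ ⊆ Ωᶜ ∩ Z`; `Z ∖ Λ = Z ∩ Ω~⁴`, `Z ∖ Z″_k = Z ∩ (Ω~⁴)~¹` (the precise content of *"obtained
  by adding one layer of M-cubes to Z″_k"*: one layer FEWER removed), `Λ ∖ Z″_k = Z ∩ (Ω~⁵ ∖ Ω~⁴)`, and `(Z″_k)~ ∩ Z ⊆ Λ`
  (an inclusion; §G shows it can be strict, so the display (1.73), not the gloss, is the definition).
* §C `Λ~`-clearance: for `t ≤ 4`, `lamT s t Ω Z ⊆ (Ω~⁽⁴⁻ᵗ⁾)ᶜ`, `lamT ∩ Z ⊆ lamZ`, and `lamT` is disjoint from every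
  `Ω′ ⊆ Ω` (all the domains `Ω_m`, m ≥ k₀+1); in particular any thickening `t ≤ 3` keeps ONE clear M-layer between `Λ~`
  and `Ω_{k₀+1}` (`lamT_subset_compl_enl_one`) — the "≤ 3 M-layers suffices" clause of C-adv3-68 — and t = 1 keeps three.
* §D (1.12) as set algebra (`OmegaPP Z″ Ω′ Z = (Z″ᶜ ∩ Z) ∪ (Ω′ ∩ Zᶜ)`): its Z-side and Zᶜ-side, monotonicity, the SHELL
  identities `(Ω″_m ∖ Ω″_{m+1}) ∩ Z = (Z″_{m+1} ∖ Z″_m) ∩ Z` and `(Ω″_m ∖ Ω″_{m+1}) ∩ Zᶜ = (Ω_m ∖ Ω_{m+1}) ∩ Zᶜ`, the TOP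
  CLAUSE of (1.64)(i) at n = N, `Ω″_k ∖ Ω_{k₀+1} = Z ∩ (Ω~⁵ ∖ Ω)` (given `Ω_k ⊆ Ω_{k₀+1}`), and p. 375's CRUCIAL DOMAIN
  `Ω″_{k₀+1} ∖ Ω_{k₀+1} = Z ∩ (Ω~⁷ ∖ Ω)`.
* §E LOCATION of the n = N regions relative to `Λ~`: the interior Z-shells lie inside `Z″_k ⊆ Λ` (hence inside `Λ~` for
  every t, under either reading) as soon as `Z″_{m+1} ⊆ Z″_k` (the printed admissibility of the completion); the top clause
  splits at depth `4 − t`: its part outside `lamZ` is `Z ∩ (Ω~⁽⁴⁻ᵗ⁾ ∖ Ω)`, its part inside is `Z ∩ (Ω~⁵ ∖ Ω~⁽⁴⁻ᵗ⁾)`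
  (equalities for `lamZ`, the corresponding inclusions for `lamT`); the (1.66)-shells and the Zᶜ-side of (1.12) at scales
  ≥ k₀+1 lie in `Ω_{k₀+1}`, off `Λ~`; the literal `Λ~` leaves `Z` only into `Zᶜ ∖ Ω~⁽⁴⁻ᵗ⁾`.
* §F below k₀: from the (3.5)-shape `Ω ⊆ ((Λ₀ᶜ)~⁸)ᶜ` with `Λ₀ ⊆ Ω′`, `Ω~⁸ ⊆ Ω′` (`enl_subset_of_omega35`); from
  `Ω~⁷ ⊆ Ω′`, every (1.11)-type region `(Ω′^{~n})ᶜ ∩ Z` (ANY cube side `s′`) and `Ω′ᶜ ∩ Z` lie inside `Z″_{k₀+1} ⊆ Λ`.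
* §G boxes and instances: for a parallelepiped `Ω = box s lo hi` the regions are explicit (`farZ_box`); a `d = 1`
  configuration exhibits all regions, the split of the top clause, the literal `Λ~` leaving `Z`, and the strictness of the
  p. 192 gloss read as "`Λ = (Z″_k)~ ∩ Z`".
* §H (v1.2) the p. 362 localization domain and the (1.3)/(1.4) constraint region relative to `Λ`, `Λ~`: `Z ∖ Λ ⊆ Ω″_k ∩ Z`
  (the constraint region of (1.3)/(1.4) lies in the TOP-LEVEL zone of the new sequence (1.12)); for every core `Z″ ⊆ Z″_k`
  (every `Z″_j`, j ≤ k, of the printed completion) `Z ∖ Λ ⊆ Ω″(Z″) ∩ Z`, so `X₀ = Z ∩ Ω″~_{h+1} ⊇ Z ∩ Ω″_{h+1} ⊇ Z ∖ Λ`;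
  the `4 − t` M-layers `Z ∩ Ω~⁽⁴⁻ᵗ⁾` lie in `Z ∖ Λ` and OFF `Λ~` under both readings; hence no superset of `Ω″(Z″) ∩ Z`
  (`X₀`, `X̃₀⁵`, …) is contained in `Λ~` as soon as `Z ∩ Ω~⁽⁴⁻ᵗ⁾ ≠ ∅` (`not_subset_lamT_of_supset`,
  `not_subset_lamZ_of_supset`; d = 1 instance `X0_ex_not_subset_lamT`: the point 0 ∈ Ω ∩ Z lies in `X₀` and not in `Λ~`).
  This answers the question of cell row C-adv3-90 (menu (q)) *"does Z ∩ Ω″~_{h+1} sit ≥ 5 M₁-cubes inside Λ~"* in the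
  NEGATIVE as set algebra (cell rows C-adv3-89 (C2), C-b02g26-1 entry O10 / (L-margin)).
  v1.3 adds the complementary identity behind cell row C-adv3-91's retyped decoration set
  `σ₀′ = {Δ : Δ ∩ (□₀ ∪ Λ~ ∪ X̃₀⁵) = ∅}`: for every `X₀` with `Ω″(Z″) ∩ Z ⊆ X₀ ⊆ Z` (core `Z″ ⊆ Z″_k`),
  `Λ ∪ X₀ = Z` (`Lam_union_eq_of_supset`), `Λ~ ∪ X₀ = Z` for the pattern `Λ~` (`lamZ_union_eq_of_supset`) and
  `Z ⊆ Λ~ ∪ X₀` for the literal one (`subset_lamT_union_of_supset`) — i.e. on the component `Z` the excluded set of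
  `σ₀′` is all of `Z`: a cube is disjoint with `Λ~ ∪ X₀` only if it is disjoint with `Z` (`disjoint_Z_of_disjoint_union`).
WHAT IS *NOT* ASSERTED: which reading of `Λ~` B16 intends, or any value of `t`; that the completed regions exist or are
parallelepipeds; anything about fields, the spaces (1.64)–(1.69), the map (1.65) or the bounds — in particular NOT the
comparison of tolerances on these regions (cell rows C-adv3-66, C-adv3-68, C-adv3-69 — adv3's.  Value = the typed geometry the stage-3
discussion of G-B16-04 (c) rests on; NOT summit progress.  Companion rows: `GAPS.md` G-B16-04, C-adv3-66, C-adv3-68,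
C-adv3-69, C-b02g20-1 (this module, v1), C-pv02g20-5 (independent LIGHT XREAD of v1), C-b02g21-1 (v1.1).

v1.1 (unit b2b-balaban-b02, gen 21; DOCSTRING-ONLY over v1 — every declaration, statement and proof byte-identical,
imports unchanged): (D1) the [IV] p. 177 item (ii) above now quotes the printed item (ii) and carries the
"rectangular parallelepipeds" sentence separately, as printed (render `…large-field-I-p003-x2.png` re-read as an image);
(I2) the docstring of `lamZ` records the `ℕ`-subtraction convention for `t > 4`.  Both from the XREAD certificate of
v1 (cell `GAPS.md` C-pv02g20-5); no Lean statement depended on either.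
v1.2 (unit b2b-balaban-b02, gen 26; APPEND-ONLY over v1.1 — every v1.1 declaration, statement and proof byte-identical,
imports unchanged): the new section §H (six theorems, after §G) and the header quotations of [II] p. 357 / 362 / 363 / 364
above; companion cell row C-b02g26-1 ((M)-locus census of [II] §1).
v1.3 (same unit and gen; APPEND-ONLY over v1.2): four theorems at the end of §H (`Lam_union_eq_of_supset`,
`lamZ_union_eq_of_supset`, `subset_lamT_union_of_supset`, `disjoint_Z_of_disjoint_union`) and the header sentence naming
them; companion cell rows C-adv3-91 ((L-margin′), σ₀′), C-b02g26-1.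
-/

namespace Literature.MathematicalPhysics.QuantumFieldTheory.Balaban1983to89.B16Stage3Regions

open Literature.MathematicalPhysics.QuantumFieldTheory.Balaban1983to89.B14DomainGeom
open Literature.MathematicalPhysics.QuantumFieldTheory.Balaban1983to89.B16PostRGeom

variable {d : ℕ}

/-! ## A. Layer cancellation and cube-union bookkeeping -/

/-- **Layer cancellation.**  Thickening the complement of `Ω~ⁿ` by `t ≤ n` layers stays outside `Ω~⁽ⁿ⁻ᵗ⁾`:
`((Ω~ⁿ)ᶜ)~ᵗ ⊆ (Ω~⁽ⁿ⁻ᵗ⁾)ᶜ` (triangle inequality for cube-index distances; no `0 < s` needed).  The case `t = n` is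
`…B14DomainGeom.enl_compl_enl_subset_compl` up to `Ω ⊆ Ω~⁰`. [folklore] -/
theorem enl_compl_enl_subset (s t n : ℕ) (htn : t ≤ n) (Ω : Set (Pt d)) :
    enl s t (enl s n Ω)ᶜ ⊆ (enl s (n - t) Ω)ᶜ := by
  rintro x ⟨y, hy, hxy⟩ ⟨z, hz, hxz⟩
  apply hy
  refine ⟨z, hz, ?_⟩
  have h := IdxNear.triangle hxy.symm hxz
  have e : t + (n - t) = n := by omega
  rw [e] at h
  exact h

/-- `X~ⁿ` is a union of side-`s` cubes, whatever `X` is (membership depends on the cube index only). [folklore] -/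
theorem isUnionOfCubes_enl (s n : ℕ) (X : Set (Pt d)) : IsUnionOfCubes s (enl s n X) := by
  intro x y hxy
  constructor
  · rintro ⟨z, hz, hn⟩
    exact ⟨z, hz, fun i => by rw [← hxy]; exact hn i⟩
  · rintro ⟨z, hz, hn⟩
    exact ⟨z, hz, fun i => by rw [hxy]; exact hn i⟩

/-- Intersections of unions of cubes are unions of cubes. [folklore] -/
theorem isUnionOfCubes_inter {s : ℕ} {X Y : Set (Pt d)} (hX : IsUnionOfCubes s X) (hY : IsUnionOfCubes s Y) :
    IsUnionOfCubes s (X ∩ Y) := fun x y hxy => by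
  simp only [Set.mem_inter_iff, hX x y hxy, hY x y hxy]

/-- If `Ω` lies `n` layers inside `Ω′` (`Ω ⊆ Ω′~⁻ⁿ`), then `Ω~ⁿ ⊆ Ω′`. [folklore] -/
theorem enl_subset_of_subset_innerN {s n : ℕ} {Ω Ω' : Set (Pt d)} (h : Ω ⊆ innerN s n Ω') : enl s n Ω ⊆ Ω' := by
  rintro x ⟨y, hy, hxy⟩
  exact (h hy).2 x hxy.symm

/-! ## B. The depth regions: (1.10) and (1.73) -/

/-- `farZ s n Ω Z = (Ω~ⁿ)ᶜ ∩ Z`: the part of the large-field region `Z` whose cubes are more than `n` cubes (in some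
direction) from every cube meeting `Ω`.  The printed regions are `n = 5, 7` ((1.10)) and `n = 4` ((1.73)). [cite:
Balaban1989LargeFieldI, (1.10) p.179, (1.73) p.192] -/
def farZ (s n : ℕ) (Ω Z : Set (Pt d)) : Set (Pt d) := (enl s n Ω)ᶜ ∩ Z

/-- `Z″_k = (Ω^{~5}_{k₀+1})ᶜ ∩ Z` — (1.10), first member (READING: `Ω` = `Ω_{k₀+1}`, M-cube layers). [cite:
Balaban1989LargeFieldI, (1.10) p.179] -/
def Zk (s : ℕ) (Ω Z : Set (Pt d)) : Set (Pt d) := farZ s 5 Ω Z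

/-- `Z″_{k₀+1} = (Ω^{~7}_{k₀+1})ᶜ ∩ Z` — (1.10), second member. [cite: Balaban1989LargeFieldI, (1.10) p.179] -/
def Zk0 (s : ℕ) (Ω Z : Set (Pt d)) : Set (Pt d) := farZ s 7 Ω Z

/-- `Λ = (Ω^{~4}_{k₀+1})ᶜ ∩ Z` — (1.73), *"the domain on which we integrate out all field variables"* (p. 192). [cite:
Balaban1989LargeFieldI, (1.73) p.192] -/
def Lam (s : ℕ) (Ω Z : Set (Pt d)) : Set (Pt d) := farZ s 4 Ω Z

/-- [folklore] -/
theorem farZ_subset_right (s n : ℕ) (Ω Z : Set (Pt d)) : farZ s n Ω Z ⊆ Z := fun _ hx => hx.2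

/-- [folklore] -/
theorem farZ_subset_compl_enl (s n : ℕ) (Ω Z : Set (Pt d)) : farZ s n Ω Z ⊆ (enl s n Ω)ᶜ := fun _ hx => hx.1

/-- A depth region does not meet `Ω` (indeed not `Ω~ⁿ`). [folklore] -/
theorem farZ_subset_compl (s n : ℕ) (Ω Z : Set (Pt d)) : farZ s n Ω Z ⊆ Ωᶜ :=
  fun _ hx hxΩ => hx.1 (subset_enl s n Ω hxΩ)

/-- Deeper regions are smaller: `n ≤ n′ → farZ n′ ⊆ farZ n`. [folklore] -/
theorem farZ_antitone (s : ℕ) {n n' : ℕ} (h : n ≤ n') (Ω Z : Set (Pt d)) : farZ s n' Ω Z ⊆ farZ s n Ω Z :=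
  fun _ hx => ⟨fun hx' => hx.1 (enl_mono_layers s h Ω hx'), hx.2⟩

/-- A depth region of a union of cubes is a union of cubes (p. 192: *"it is a union of M-cubes"*, here from `Z` being
one; the print derives it from the index `k₀`). [folklore] -/
theorem isUnionOfCubes_farZ (s n : ℕ) (Ω : Set (Pt d)) {Z : Set (Pt d)} (hZ : IsUnionOfCubes s Z) :
    IsUnionOfCubes s (farZ s n Ω Z) :=
  isUnionOfCubes_inter (isUnionOfCubes_enl s n Ω).compl hZ

/-- Membership in a depth region, unfolded. [folklore] -/
theorem mem_farZ_iff (s n : ℕ) (Ω Z : Set (Pt d)) (x : Pt d) :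
    x ∈ farZ s n Ω Z ↔ x ∈ Z ∧ ∀ y ∈ Ω, ¬ IdxNear s n x y := by
  simp only [farZ, enl, Set.mem_inter_iff, Set.mem_compl_iff, Set.mem_setOf_eq, not_exists, not_and]
  tauto

/-- THE TOWER, first step: `Z″_{k₀+1} ⊆ Z″_k`. [folklore] -/
theorem Zk0_subset_Zk (s : ℕ) (Ω Z : Set (Pt d)) : Zk0 s Ω Z ⊆ Zk s Ω Z := farZ_antitone s (by norm_num) Ω Z

/-- THE TOWER, second step: `Z″_k ⊆ Λ`. [folklore] -/
theorem Zk_subset_Lam (s : ℕ) (Ω Z : Set (Pt d)) : Zk s Ω Z ⊆ Lam s Ω Z := farZ_antitone s (by norm_num) Ω Z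

/-- `Λ ⊆ Z`. [folklore] -/
theorem Lam_subset_Z (s : ℕ) (Ω Z : Set (Pt d)) : Lam s Ω Z ⊆ Z := farZ_subset_right s 4 Ω Z

/-- `Λ ∩ Ω_{k₀+1} = ∅` (indeed `Λ ∩ Ω^{~4}_{k₀+1} = ∅`). [folklore] -/
theorem Lam_subset_compl (s : ℕ) (Ω Z : Set (Pt d)) : Lam s Ω Z ⊆ Ωᶜ := farZ_subset_compl s 4 Ω Z

/-- What is removed from `Z` to get `Λ`: `Z ∖ Λ = Z ∩ Ω~⁴`. [folklore] -/
theorem diff_Lam_eq (s : ℕ) (Ω Z : Set (Pt d)) : Z \ Lam s Ω Z = Z ∩ enl s 4 Ω := by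
  ext x
  simp only [Lam, farZ, Set.mem_sdiff, Set.mem_inter_iff, Set.mem_compl_iff]
  tauto

/-- What is removed from `Z` to get `Z″_k`: `Z ∖ Z″_k = Z ∩ Ω~⁵`. [folklore] -/
theorem diff_Zk_eq (s : ℕ) (Ω Z : Set (Pt d)) : Z \ Zk s Ω Z = Z ∩ enl s 5 Ω := by
  ext x
  simp only [Zk, farZ, Set.mem_sdiff, Set.mem_inter_iff, Set.mem_compl_iff]
  tauto

/-- The p. 192 gloss made precise: `Z ∖ Z″_k = Z ∩ (Ω~⁴)~¹` — exactly ONE more layer is removed from `Z` for `Z″_k` than for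
`Λ` (`0 < s`: layers compose, `enl_enl`). [cite: Balaban1989LargeFieldI, p.192 (sentence after (1.73))] -/
theorem diff_Zk_eq_layer (s : ℕ) (hs : 0 < s) (Ω Z : Set (Pt d)) : Z \ Zk s Ω Z = Z ∩ enl s 1 (enl s 4 Ω) := by
  rw [diff_Zk_eq, enl_enl s 4 1 hs]

/-- The added layer itself: `Λ ∖ Z″_k = Z ∩ (Ω~⁵ ∖ Ω~⁴)`. [folklore] -/
theorem Lam_diff_Zk_eq (s : ℕ) (Ω Z : Set (Pt d)) : Lam s Ω Z \ Zk s Ω Z = Z ∩ (enl s 5 Ω \ enl s 4 Ω) := by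
  ext x
  simp only [Lam, Zk, farZ, Set.mem_sdiff, Set.mem_inter_iff, Set.mem_compl_iff]
  tauto

/-- The gloss as an INCLUSION: one layer around `Z″_k`, inside `Z`, lies in `Λ` — `(Z″_k)~ ∩ Z ⊆ Λ`.  (Not an equality in
general: `not_Lam_subset_enl_Zk` in §G.) [folklore] -/
theorem enl_Zk_inter_subset_Lam (s : ℕ) (Ω Z : Set (Pt d)) : enl s 1 (Zk s Ω Z) ∩ Z ⊆ Lam s Ω Z := by
  rintro x ⟨hx, hxZ⟩
  refine ⟨?_, hxZ⟩
  have h1 : enl s 1 (Zk s Ω Z) ⊆ enl s 1 (enl s 5 Ω)ᶜ := enl_mono s 1 (farZ_subset_compl_enl s 5 Ω Z)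
  exact enl_compl_enl_subset s 1 5 (by norm_num) Ω (h1 hx)

/-! ## C. The thickened `Λ~` of B16 p. 375 under both readings -/

/-- LITERAL reading of `Λ~`: `Λ` thickened by `t` layers of M-cubes ([I] p. 257: `X~ = X~¹`, so t = 1 is the
convention; t is kept a parameter because B16 does not define the symbol). [cite: Balaban1989LargeFieldII, p.375 (Λ~, undefined);
Balaban1987RG1, p.257 (X̃ⁿ)] -/
def lamT (s t : ℕ) (Ω Z : Set (Pt d)) : Set (Pt d) := enl s t (Lam s Ω Z)

/-- PATTERN reading of `Λ~`: one depth level less than `Λ`, `(Ω^{~(4−t)}_{k₀+1})ᶜ ∩ Z` (the shape of (1.10)/(1.73), where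
`(Z′)^{~3}`, `(Z′)^~` are rendered as `(Ω^{~5})ᶜ ∩ Z`, `(Ω^{~7})ᶜ ∩ Z`).  Convention (v1.1 remark): `4 - t` is truncated
`ℕ`-subtraction, so for `t > 4` it is `0` and `lamZ s t Ω Z = farZ s 0 Ω Z = (Ω~⁰)ᶜ ∩ Z` (`Ω~⁰` = the union of the
M-cubes meeting `Ω`, i.e. `Ω` itself when `Ω` is a union of M-cubes) — the pattern reading saturates at depth `0`
instead of entering `Ω`.  The intended range is `t ≤ 4`; the statements below about `lamZ` are either phrased through the
same truncated `4 - t` (`lamZ_subset`, `top_diff_lamZ`, `top_inter_lamZ`), or true for every `t` (`Lam_subset_lamZ`,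
`shell_subset_lamT`'s `lamZ` half, `inside_old_disjoint_lamZ`), or carry `t ≤ 4` explicitly where the literal reading is
compared (`lamT_inter_subset_lamZ`, `lamT_subset_lamZ_of_absorb`), so no statement says anything unintended for `t > 4`. [cite: Balaban1989LargeFieldII, p.375 (Λ~, undefined);
Balaban1989LargeFieldI, (1.10) p.179] -/
def lamZ (s t : ℕ) (Ω Z : Set (Pt d)) : Set (Pt d) := farZ s (4 - t) Ω Z

/-- `Λ ⊆ Λ~` (literal). [folklore] -/
theorem Lam_subset_lamT (s t : ℕ) (Ω Z : Set (Pt d)) : Lam s Ω Z ⊆ lamT s t Ω Z := subset_enl s t _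

/-- `Λ ⊆ Λ~` (pattern). [folklore] -/
theorem Lam_subset_lamZ (s t : ℕ) (Ω Z : Set (Pt d)) : Lam s Ω Z ⊆ lamZ s t Ω Z := farZ_antitone s (by omega) Ω Z

/-- The pattern `Λ~` stays inside `Z` and outside `Ω~⁽⁴⁻ᵗ⁾`. [folklore] -/
theorem lamZ_subset (s t : ℕ) (Ω Z : Set (Pt d)) : lamZ s t Ω Z ⊆ (enl s (4 - t) Ω)ᶜ ∩ Z := fun _ hx => hx

/-- **Clearance of the literal `Λ~`.**  For `t ≤ 4`: `Λ~ ⊆ (Ω^{~(4−t)}_{k₀+1})ᶜ`. [folklore] -/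
theorem lamT_subset_compl_enl (s t : ℕ) (ht : t ≤ 4) (Ω Z : Set (Pt d)) : lamT s t Ω Z ⊆ (enl s (4 - t) Ω)ᶜ :=
  fun _ hx => enl_compl_enl_subset s t 4 ht Ω (enl_mono s t (farZ_subset_compl_enl s 4 Ω Z) hx)

/-- The two readings compare: inside `Z` the literal `Λ~` is contained in the pattern `Λ~` (same `t ≤ 4`). [folklore] -/
theorem lamT_inter_subset_lamZ (s t : ℕ) (ht : t ≤ 4) (Ω Z : Set (Pt d)) : lamT s t Ω Z ∩ Z ⊆ lamZ s t Ω Z :=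
  fun _ hx => ⟨lamT_subset_compl_enl s t ht Ω Z hx.1, hx.2⟩

/-- For `t ≤ 4` the literal `Λ~` misses `Ω_{k₀+1}` and every later domain inside it (`Ω_m ⊆ Ω_{k₀+1}`,
m = k₀+1, …, k). [folklore] -/
theorem lamT_disjoint_of_subset (s t : ℕ) (ht : t ≤ 4) {Ω Ω' Z : Set (Pt d)} (hΩ' : Ω' ⊆ Ω) :
    Disjoint (lamT s t Ω Z) Ω' := by
  rw [Set.disjoint_left]
  intro x hx hx'
  exact lamT_subset_compl_enl s t ht Ω Z hx (subset_enl s (4 - t) Ω (hΩ' hx'))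

/-- `t ≤ 4`: `Λ~ ⊆ Ω_{k₀+1}ᶜ`. [folklore] -/
theorem lamT_subset_compl (s t : ℕ) (ht : t ≤ 4) (Ω Z : Set (Pt d)) : lamT s t Ω Z ⊆ Ωᶜ :=
  fun _ hx hxΩ => lamT_subset_compl_enl s t ht Ω Z hx (subset_enl s (4 - t) Ω hxΩ)

/-- **"≤ 3 M-layers suffices"** (cell row C-adv3-68): any thickening `t ≤ 3` keeps one clear M-layer, `Λ~ ⊆ (Ω~¹_{k₀+1})ᶜ`.
[folklore] -/
theorem lamT_subset_compl_enl_one (s t : ℕ) (ht : t ≤ 3) (Ω Z : Set (Pt d)) : lamT s t Ω Z ⊆ (enl s 1 Ω)ᶜ :=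
  fun _ hx h1 => lamT_subset_compl_enl s t (by omega) Ω Z hx (enl_mono_layers s (by omega) Ω h1)

/-- The [I] p. 257 convention `t = 1`: `Λ~ ⊆ (Ω~³_{k₀+1})ᶜ` — three clear M-layers. [folklore] -/
theorem lamT_one_subset (s : ℕ) (Ω Z : Set (Pt d)) : lamT s 1 Ω Z ⊆ (enl s 3 Ω)ᶜ :=
  lamT_subset_compl_enl s 1 (by norm_num) Ω Z

/-- Where the literal `Λ~` leaves `Z`: only into `Zᶜ ∖ Ω~⁽⁴⁻ᵗ⁾` (`t ≤ 4`). [folklore] -/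
theorem lamT_diff_subset (s t : ℕ) (ht : t ≤ 4) (Ω Z : Set (Pt d)) : lamT s t Ω Z \ Z ⊆ Zᶜ \ enl s (4 - t) Ω :=
  fun _ hx => ⟨hx.2, lamT_subset_compl_enl s t ht Ω Z hx.1⟩

/-- If `Z` absorbs `t` layers around its far part (`(Ωᶜ ∩ Z)~ᵗ ⊆ Z`, e.g. `Z` a union of whole components separated from
the rest of the old large-field region), the literal `Λ~` stays in `Z` and the two readings nest: `lamT ⊆ lamZ`. [folklore] -/
theorem lamT_subset_lamZ_of_absorb (s t : ℕ) (ht : t ≤ 4) {Ω Z : Set (Pt d)} (hZ : enl s t (Ωᶜ ∩ Z) ⊆ Z) :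
    lamT s t Ω Z ⊆ lamZ s t Ω Z := by
  intro x hx
  have hsub : Lam s Ω Z ⊆ Ωᶜ ∩ Z := fun y hy => ⟨Lam_subset_compl s Ω Z hy, Lam_subset_Z s Ω Z hy⟩
  have hxZ : x ∈ Z := hZ (enl_mono s t hsub hx)
  exact lamT_inter_subset_lamZ s t ht Ω Z ⟨hx, hxZ⟩

/-! ## D. (1.12): the new domains, their shells, the top clause and the crucial domain -/

/-- (1.12): `Ω″_j = (Z″ᶜ_j ∩ Z) ∪ (Ω_j ∩ Zᶜ)` as a function of the new large-field region `Z″ = Z″_j`, the old domain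
`Ω′ = Ω_j` and `Z`. [cite: Balaban1989LargeFieldI, (1.12) p.179] -/
def OmegaPP (Zpp Ω' Z : Set (Pt d)) : Set (Pt d) := (Zppᶜ ∩ Z) ∪ (Ω' ∩ Zᶜ)

/-- Inside `Z` the new domain is the complement of the new large-field region. [folklore] -/
theorem omegaPP_inter_Z (Zpp Ω' Z : Set (Pt d)) : OmegaPP Zpp Ω' Z ∩ Z = Zppᶜ ∩ Z := by
  ext x
  simp only [OmegaPP, Set.mem_inter_iff, Set.mem_union, Set.mem_compl_iff]
  tauto

/-- Outside `Z` the new domain is the old one. [folklore] -/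
theorem omegaPP_inter_compl_Z (Zpp Ω' Z : Set (Pt d)) : OmegaPP Zpp Ω' Z ∩ Zᶜ = Ω' ∩ Zᶜ := by
  ext x
  simp only [OmegaPP, Set.mem_inter_iff, Set.mem_union, Set.mem_compl_iff]
  tauto

/-- Monotonicity: growing `Z″` and shrinking `Ω′` shrink `Ω″` (how *"the complements of these sets form an admissible
[= descending] sequence"* transfers to `{Ω″_j}`). [folklore] -/
theorem omegaPP_mono {Zpp Zpp' Ω' Ω'' Z : Set (Pt d)} (hZ : Zpp ⊆ Zpp') (hΩ : Ω'' ⊆ Ω') :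
    OmegaPP Zpp' Ω'' Z ⊆ OmegaPP Zpp Ω' Z := by
  rintro x (⟨hx, hxZ⟩ | ⟨hx, hxZ⟩)
  · exact Or.inl ⟨fun h => hx (hZ h), hxZ⟩
  · exact Or.inr ⟨hΩ hx, hxZ⟩

/-- **Shell identity, Z-side.**  `(Ω″_m ∖ Ω″_{m+1}) ∩ Z = (Z″_{m+1} ∖ Z″_m) ∩ Z` for any two levels. [folklore] -/
theorem shell_inter_Z (Zm Zm1 Ωm Ωm1 Z : Set (Pt d)) :
    (OmegaPP Zm Ωm Z \ OmegaPP Zm1 Ωm1 Z) ∩ Z = (Zm1 \ Zm) ∩ Z := by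
  ext x
  simp only [OmegaPP, Set.mem_sdiff, Set.mem_inter_iff, Set.mem_union, Set.mem_compl_iff]
  tauto

/-- **Shell identity, Zᶜ-side.**  `(Ω″_m ∖ Ω″_{m+1}) ∩ Zᶜ = (Ω_m ∖ Ω_{m+1}) ∩ Zᶜ`. [folklore] -/
theorem shell_inter_compl_Z (Zm Zm1 Ωm Ωm1 Z : Set (Pt d)) :
    (OmegaPP Zm Ωm Z \ OmegaPP Zm1 Ωm1 Z) ∩ Zᶜ = (Ωm \ Ωm1) ∩ Zᶜ := by
  ext x
  simp only [OmegaPP, Set.mem_sdiff, Set.mem_inter_iff, Set.mem_union, Set.mem_compl_iff]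
  tauto

/-- `Ω″_k ∩ Z = Ω~⁵ ∩ Z` (the Z-side of the top new domain). [folklore] -/
theorem omegaPP_Zk_inter_Z (s : ℕ) (Ω Ωk Z : Set (Pt d)) : OmegaPP (Zk s Ω Z) Ωk Z ∩ Z = enl s 5 Ω ∩ Z := by
  ext x
  simp only [OmegaPP, Zk, farZ, Set.mem_inter_iff, Set.mem_union, Set.mem_compl_iff]
  tauto

/-- **The top clause of (1.64)(i) at n = N** (m = j = k: *"on (Ω″_j ∖ Ω_{k₀+1}) ∩ X for m = j"*): with `Ω_k ⊆ Ω_{k₀+1}`,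
`Ω″_k ∖ Ω_{k₀+1} = Z ∩ (Ω~⁵ ∖ Ω)` — the five M-layers around `Ω_{k₀+1}` inside `Z`, nothing outside `Z`. [cite:
Balaban1989LargeFieldI, (1.64)(i) p.190, (1.10)–(1.12) p.179] -/
theorem top_eq (s : ℕ) {Ω Ωk Z : Set (Pt d)} (hΩk : Ωk ⊆ Ω) :
    OmegaPP (Zk s Ω Z) Ωk Z \ Ω = Z ∩ (enl s 5 Ω \ Ω) := by
  ext x
  simp only [OmegaPP, Zk, farZ, Set.mem_sdiff, Set.mem_inter_iff, Set.mem_union, Set.mem_compl_iff]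
  constructor
  · rintro ⟨(⟨h, hxZ⟩ | ⟨hxk, -⟩), hxΩ⟩
    · exact ⟨hxZ, by tauto, hxΩ⟩
    · exact absurd (hΩk hxk) hxΩ
  · rintro ⟨hxZ, h5, hxΩ⟩
    exact ⟨Or.inl ⟨fun h => h.1 h5, hxZ⟩, hxΩ⟩

/-- Without any hypothesis on `Ω_k`: the Z-side of the top clause, `(Ω″_k ∖ Ω_{k₀+1}) ∩ Z = Z ∩ (Ω~⁵ ∖ Ω)`. [folklore] -/
theorem top_inter_Z (s : ℕ) (Ω Ωk Z : Set (Pt d)) :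
    (OmegaPP (Zk s Ω Z) Ωk Z \ Ω) ∩ Z = Z ∩ (enl s 5 Ω \ Ω) := by
  ext x
  simp only [OmegaPP, Zk, farZ, Set.mem_sdiff, Set.mem_inter_iff, Set.mem_union, Set.mem_compl_iff]
  tauto

/-- **The crucial domain of B16 p. 375**, `Ω″_{k₀+1} ∖ Ω_{k₀+1} = Z ∩ (Ω~⁷ ∖ Ω)`: the seven M-layers around `Ω_{k₀+1}`
inside `Z` ((1.12) at j = k₀+1 with (1.10)). [cite: Balaban1989LargeFieldII, p.375 ("the crucial domain Ω″_{k₀+1}∖Ω_{k₀+1}");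
Balaban1989LargeFieldI, (1.10)–(1.12) p.179] -/
theorem crucial_eq (s : ℕ) (Ω Z : Set (Pt d)) : OmegaPP (Zk0 s Ω Z) Ω Z \ Ω = Z ∩ (enl s 7 Ω \ Ω) := by
  ext x
  simp only [OmegaPP, Zk0, farZ, Set.mem_sdiff, Set.mem_inter_iff, Set.mem_union, Set.mem_compl_iff]
  tauto

/-- The top clause is the outer five of the crucial domain's seven layers. [folklore] -/
theorem top_subset_crucial (s : ℕ) (Ω Z : Set (Pt d)) : Z ∩ (enl s 5 Ω \ Ω) ⊆ Z ∩ (enl s 7 Ω \ Ω) :=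
  fun _ hx => ⟨hx.1, enl_mono_layers s (by norm_num) Ω hx.2.1, hx.2.2⟩

/-! ## E. Location of the n = N regions relative to `Λ`, `Λ~`, `Z″_k` -/

/-- **Interior Z-shells lie inside `Z″_k`.**  For two consecutive levels with `Z″_{m+1} ⊆ Z″_k` (the printed completion is
increasing up to `Z″_k`): `(Ω″_m ∖ Ω″_{m+1}) ∩ Z ⊆ Z″_k`. [folklore] -/
theorem shell_subset_Zk (s : ℕ) {Ω Z Zm Zm1 Ωm Ωm1 : Set (Pt d)} (h : Zm1 ⊆ Zk s Ω Z) :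
    (OmegaPP Zm Ωm Z \ OmegaPP Zm1 Ωm1 Z) ∩ Z ⊆ Zk s Ω Z := by
  rw [shell_inter_Z]
  exact fun _ hx => h hx.1.1

/-- … hence inside `Λ` (two printed levels below the layer where `Λ~` matters), [folklore] -/
theorem shell_subset_Lam (s : ℕ) {Ω Z Zm Zm1 Ωm Ωm1 : Set (Pt d)} (h : Zm1 ⊆ Zk s Ω Z) :
    (OmegaPP Zm Ωm Z \ OmegaPP Zm1 Ωm1 Z) ∩ Z ⊆ Lam s Ω Z :=
  (shell_subset_Zk s h).trans (Zk_subset_Lam s Ω Z)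

/-- … hence inside `Λ~` for every thickening, under either reading. [folklore] -/
theorem shell_subset_lamT (s t : ℕ) {Ω Z Zm Zm1 Ωm Ωm1 : Set (Pt d)} (h : Zm1 ⊆ Zk s Ω Z) :
    (OmegaPP Zm Ωm Z \ OmegaPP Zm1 Ωm1 Z) ∩ Z ⊆ lamT s t Ω Z ∩ lamZ s t Ω Z :=
  fun _ hx => ⟨Lam_subset_lamT s t Ω Z (shell_subset_Lam s h hx), Lam_subset_lamZ s t Ω Z (shell_subset_Lam s h hx)⟩

/-- The shell between the two PRINTED regions of (1.10) (the completed intermediate levels `Z″_{k−1}, …, Z″_{k₀+2}`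
left aside): inside `Z`, `Ω″(Z″_{k₀+1}) ∖ Ω″(Z″_k) = Z ∩ (Ω~⁷ ∖ Ω~⁵)` (`⊆ Z″_k`). [folklore] -/
theorem printed_shell_eq (s : ℕ) (Ω Ωa Ωb Z : Set (Pt d)) :
    (OmegaPP (Zk0 s Ω Z) Ωa Z \ OmegaPP (Zk s Ω Z) Ωb Z) ∩ Z = Z ∩ (enl s 7 Ω \ enl s 5 Ω) := by
  rw [shell_inter_Z]
  ext x
  simp only [Zk, Zk0, farZ, Set.mem_sdiff, Set.mem_inter_iff, Set.mem_compl_iff]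
  tauto

/-- **Split of the top clause by the pattern `Λ~`** (`t ≤ 4`), inner part: what lies OUTSIDE `Λ~` is exactly the
`4 − t` M-layers next to `Ω_{k₀+1}`: `(Z ∩ (Ω~⁵ ∖ Ω)) ∖ Λ~ = Z ∩ (Ω~⁽⁴⁻ᵗ⁾ ∖ Ω)`. [folklore] -/
theorem top_diff_lamZ (s t : ℕ) (ht : t ≤ 4) (Ω Z : Set (Pt d)) :
    (Z ∩ (enl s 5 Ω \ Ω)) \ lamZ s t Ω Z = Z ∩ (enl s (4 - t) Ω \ Ω) := by
  ext x
  simp only [lamZ, farZ, Set.mem_sdiff, Set.mem_inter_iff, Set.mem_compl_iff, not_and]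
  constructor
  · rintro ⟨⟨hxZ, -, hxΩ⟩, h⟩
    have h4 : x ∈ enl s (4 - t) Ω := by
      by_contra h'
      exact h h' hxZ
    exact ⟨hxZ, h4, hxΩ⟩
  · rintro ⟨hxZ, h4, hxΩ⟩
    exact ⟨⟨hxZ, enl_mono_layers s (by omega) Ω h4, hxΩ⟩, fun h _ => h h4⟩

/-- **Split of the top clause by the pattern `Λ~`**, outer part: `(Z ∩ (Ω~⁵ ∖ Ω)) ∩ Λ~ = Z ∩ (Ω~⁵ ∖ Ω~⁽⁴⁻ᵗ⁾)` — the outer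
`t + 1` layers. [folklore] -/
theorem top_inter_lamZ (s t : ℕ) (Ω Z : Set (Pt d)) :
    (Z ∩ (enl s 5 Ω \ Ω)) ∩ lamZ s t Ω Z = Z ∩ (enl s 5 Ω \ enl s (4 - t) Ω) := by
  ext x
  simp only [lamZ, farZ, Set.mem_sdiff, Set.mem_inter_iff, Set.mem_compl_iff]
  constructor
  · rintro ⟨⟨hxZ, h5, -⟩, h4, -⟩
    exact ⟨hxZ, h5, h4⟩
  · rintro ⟨hxZ, h5, h4⟩
    exact ⟨⟨hxZ, h5, fun hxΩ => h4 (subset_enl s (4 - t) Ω hxΩ)⟩, h4, hxZ⟩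

/-- The same split for the LITERAL `Λ~` (`t ≤ 4`), as inclusions: the part of the top clause met by `Λ~` lies in the outer
`t + 1` layers … [folklore] -/
theorem top_inter_lamT_subset (s t : ℕ) (ht : t ≤ 4) (Ω Z : Set (Pt d)) :
    (Z ∩ (enl s 5 Ω \ Ω)) ∩ lamT s t Ω Z ⊆ Z ∩ (enl s 5 Ω \ enl s (4 - t) Ω) :=
  fun _ hx => ⟨hx.1.1, hx.1.2.1, lamT_subset_compl_enl s t ht Ω Z hx.2⟩

/-- … and the `4 − t` layers next to `Ω_{k₀+1}` are NOT met by it. [folklore] -/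
theorem inner_layers_subset_top_diff_lamT (s t : ℕ) (ht : t ≤ 4) (Ω Z : Set (Pt d)) :
    Z ∩ (enl s (4 - t) Ω \ Ω) ⊆ (Z ∩ (enl s 5 Ω \ Ω)) \ lamT s t Ω Z :=
  fun _ hx => ⟨⟨hx.1, enl_mono_layers s (by omega) Ω hx.2.1, hx.2.2⟩,
    fun h => lamT_subset_compl_enl s t ht Ω Z h hx.2.1⟩

/-- **The (1.66)-shells and the Zᶜ-side of (1.12) at scales ≥ k₀+1 are off `Λ~`:** any region inside some `Ω_m ⊆ Ω_{k₀+1}`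
is disjoint from the literal `Λ~` (`t ≤ 4`) … [folklore] -/
theorem inside_old_disjoint_lamT (s t : ℕ) (ht : t ≤ 4) {Ω Ωm S Z : Set (Pt d)} (hΩm : Ωm ⊆ Ω) (hS : S ⊆ Ωm) :
    Disjoint S (lamT s t Ω Z) :=
  Disjoint.symm ((lamT_disjoint_of_subset s t ht (Z := Z) hΩm).mono_right hS)

/-- … and from the pattern `Λ~` (any `t`). [folklore] -/
theorem inside_old_disjoint_lamZ (s t : ℕ) {Ω Ωm S Z : Set (Pt d)} (hΩm : Ωm ⊆ Ω) (hS : S ⊆ Ωm) :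
    Disjoint S (lamZ s t Ω Z) := by
  rw [Set.disjoint_left]
  intro x hxS hx
  exact farZ_subset_compl s (4 - t) Ω Z hx (hΩm (hS hxS))

/-- Zᶜ-side shells of the high scales: `(Ω″_m ∖ Ω″_{m+1}) ∩ Zᶜ` with `Ω_m ⊆ Ω_{k₀+1}` misses the literal `Λ~` (`t ≤ 4`).
[folklore] -/
theorem shell_compl_Z_disjoint_lamT (s t : ℕ) (ht : t ≤ 4) {Ω Z Zm Zm1 Ωm Ωm1 : Set (Pt d)} (hΩm : Ωm ⊆ Ω) :
    Disjoint ((OmegaPP Zm Ωm Z \ OmegaPP Zm1 Ωm1 Z) ∩ Zᶜ) (lamT s t Ω Z) := by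
  rw [shell_inter_compl_Z]
  exact inside_old_disjoint_lamT s t ht hΩm (fun _ hx => hx.1.1)

/-! ## F. Below the scale k₀+1: the (3.5) margin and the regions (1.11) -/

/-- **The margin from [III] (3.5)** in the typed shape of `…B14DomainGeom.omega35_subset_compl_enl`: if
`Ω ⊆ ((Λ₀ᶜ)~ⁿ)ᶜ` (`Ω = Ω_{k₀+1}`, `Λ₀ = Λ_{k₀}`, `n = 8` layers of the cubes which the definition of N₀ makes the M-cubes of the
k-th step) and `Λ₀ ⊆ Ω′` ((2.1): `Λ_{k₀} ⊆ Ω_{k₀} ⊆ Ω_m`, m ≤ k₀), then `Ω~ⁿ ⊆ Ω′`. [cite: Balaban1988Convergent, (3.5) p.265,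
(2.1) p.254; Balaban1989LargeFieldI, p.179 (definition of N₀)] -/
theorem enl_subset_of_omega35 {s n : ℕ} {Ω Λ0 Ω' : Set (Pt d)} (h35 : Ω ⊆ (enl s n Λ0ᶜ)ᶜ) (hΛ0 : Λ0 ⊆ Ω') :
    enl s n Ω ⊆ Ω' := by
  rintro x ⟨y, hy, hxy⟩
  by_contra hx
  exact h35 hy ⟨x, fun hxΛ => hx (hΛ0 hxΛ), hxy.symm⟩

/-- With the margin `Ω~⁷ ⊆ Ω′`: the part of `Z` outside an older domain `Ω′` lies in `Z″_{k₀+1}`. [folklore] -/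
theorem compl_inter_subset_Zk0 (s : ℕ) {Ω Ω' Z : Set (Pt d)} (h7 : enl s 7 Ω ⊆ Ω') : Ω'ᶜ ∩ Z ⊆ Zk0 s Ω Z :=
  fun _ hx => ⟨fun h => hx.1 (h7 h), hx.2⟩

/-- With the margin `Ω~⁷ ⊆ Ω′`: every (1.11)-type region `(Ω′^{~n})ᶜ ∩ Z` of an older domain — for ANY cube side `s′`
(its own, finer family) and any `n` — lies in `Z″_{k₀+1}`, hence in `Z″_k ⊆ Λ`. [cite: Balaban1989LargeFieldI, (1.11) p.179] -/
theorem farZ_older_subset_Zk0 (s s' n : ℕ) {Ω Ω' Z : Set (Pt d)} (h7 : enl s 7 Ω ⊆ Ω') :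
    farZ s' n Ω' Z ⊆ Zk0 s Ω Z :=
  fun _ hx => compl_inter_subset_Zk0 s h7 ⟨fun h => hx.1 (subset_enl s' n Ω' h), hx.2⟩

/-- The chain by name: from the (3.5)-shape `Ω ⊆ ((Λ₀ᶜ)~⁸)ᶜ` and `Λ₀ ⊆ Ω′`, every (1.11)-type region of `Ω′` lies in
`Z″_{k₀+1}` (`enl_subset_of_omega35`, one layer to spare). [cite: Balaban1988Convergent, (3.5) p.265; Balaban1989LargeFieldI,
(1.11) p.179] -/
theorem farZ_older_subset_Zk0_of_omega35 (s s' n : ℕ) {Ω Λ0 Ω' Z : Set (Pt d)} (h35 : Ω ⊆ (enl s 8 Λ0ᶜ)ᶜ)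
    (hΛ0 : Λ0 ⊆ Ω') : farZ s' n Ω' Z ⊆ Zk0 s Ω Z :=
  farZ_older_subset_Zk0 s s' n ((enl_mono_layers s (by norm_num) Ω).trans (enl_subset_of_omega35 h35 hΛ0))

/-- Consequently the Z-side shells built from (1.11)-regions of older domains lie in `Λ` as well:
`(Z″_{m+1} ∖ Z″_m) ∩ Z ⊆ Λ` whenever `Z″_{m+1} = (Ω′^{~n})ᶜ ∩ Z` with `Ω~⁷ ⊆ Ω′`. [folklore] -/
theorem older_shell_subset_Lam (s s' n : ℕ) {Ω Ω' Z Zm Ωm Ωm1 : Set (Pt d)} (h7 : enl s 7 Ω ⊆ Ω') :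
    (OmegaPP Zm Ωm Z \ OmegaPP (farZ s' n Ω' Z) Ωm1 Z) ∩ Z ⊆ Lam s Ω Z :=
  shell_subset_Lam s ((farZ_older_subset_Zk0 s s' n h7).trans (Zk0_subset_Zk s Ω Z))

/-! ## G. Parallelepipeds and a `d = 1` configuration (non-vacuity; strictness of the p. 192 gloss) -/

/-- For a parallelepiped old domain `Ω = box s lo hi` (non-empty, `0 < s`) the depth regions are explicit:
`farZ s n Ω Z = Z ∖ box s (lo − n) (hi + n)`. [folklore] -/
theorem farZ_box (s n : ℕ) (hs : 0 < s) (lo hi : Pt d) (hle : ∀ i, lo i ≤ hi i) (Z : Set (Pt d)) :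
    farZ s n (box s lo hi) Z = Z \ box s (fun i => lo i - n) (fun i => hi i + n) := by
  rw [farZ, enl_box s n hs lo hi hle, Set.sdiff_eq, Set.inter_comm]

namespace OneDim

/-- The point `a` of `ℤ¹`. [folklore] -/
def pt (a : ℤ) : Pt 1 := fun _ => a

/-- With unit cubes (`s = 1`) the cube index is the point. [folklore] -/
theorem cubeIdx_one (x : Pt 1) : cubeIdx 1 x = x := by
  funext i
  simp [cubeIdx]

/-- [folklore] -/
theorem idxNear_one_iff (n : ℕ) (x y : Pt 1) : IdxNear 1 n x y ↔ |x 0 - y 0| ≤ n := by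
  unfold IdxNear
  rw [cubeIdx_one, cubeIdx_one]
  constructor
  · intro h; exact h 0
  · intro h i
    have hi : i = 0 := Subsingleton.elim _ _
    subst hi; exact h

/-- The old domain of the example: the half-line `{x ≤ 0}` (playing `Ω_{k₀+1}`). [folklore] -/
def Ωex : Set (Pt 1) := {x | x 0 ≤ 0}

/-- The large-field region of the example: the interval `[-3, 30]` (it meets `Ω`). [folklore] -/
def Zex : Set (Pt 1) := {x | -3 ≤ x 0 ∧ x 0 ≤ 30}

/-- `Ω~ⁿ = {x ≤ n}` for the half-line. [folklore] -/
theorem enl_Ωex (n : ℕ) : enl 1 n Ωex = {x : Pt 1 | x 0 ≤ n} := by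
  ext x
  simp only [enl, Ωex, Set.mem_setOf_eq]
  constructor
  · rintro ⟨y, hy, hn⟩
    have h := (idxNear_one_iff n x y).1 hn
    rw [abs_le] at h
    linarith [h.2]
  · intro hx
    refine ⟨pt (min (x 0) 0), min_le_right _ _, (idxNear_one_iff n x _).2 ?_⟩
    simp only [pt]
    rw [abs_le]
    constructor
    · linarith [min_le_left (x 0) 0]
    · rcases le_total (x 0) 0 with h | h
      · rw [min_eq_left h]; simp
      · rw [min_eq_right h]; linarith

/-- `farZ 1 n Ωex Zex = {n < x ≤ 30}` (for `n + 1 ≥ -3`, i.e. always). [folklore] -/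
theorem farZ_ex (n : ℕ) : farZ 1 n Ωex Zex = {x : Pt 1 | (n : ℤ) < x 0 ∧ x 0 ≤ 30} := by
  ext x
  rw [farZ, enl_Ωex]
  simp only [Zex, Set.mem_inter_iff, Set.mem_compl_iff, Set.mem_setOf_eq, not_le]
  constructor
  · rintro ⟨h1, -, h3⟩; exact ⟨h1, h3⟩
  · rintro ⟨h1, h3⟩; exact ⟨h1, by omega, h3⟩

/-- The regions of the example: `Λ = (4, 30]`, `Z″_k = (5, 30]`, `Z″_{k₀+1} = (7, 30]`, pattern `Λ~` (t = 1) `= (3, 30]`.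
[folklore] -/
theorem regions_ex :
    Lam 1 Ωex Zex = {x : Pt 1 | 4 < x 0 ∧ x 0 ≤ 30} ∧ Zk 1 Ωex Zex = {x : Pt 1 | 5 < x 0 ∧ x 0 ≤ 30} ∧
      Zk0 1 Ωex Zex = {x : Pt 1 | 7 < x 0 ∧ x 0 ≤ 30} ∧ lamZ 1 1 Ωex Zex = {x : Pt 1 | 3 < x 0 ∧ x 0 ≤ 30} := by
  refine ⟨?_, ?_, ?_, ?_⟩
  · exact farZ_ex 4
  · exact farZ_ex 5
  · exact farZ_ex 7
  · exact farZ_ex 3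

/-- The literal `Λ~` (t = 1) of the example is `[4, 31]`: it reaches depth 4 exactly like the pattern reading, and it
LEAVES `Z` at the far end (the point 31). [folklore] -/
theorem lamT_ex : lamT 1 1 Ωex Zex = {x : Pt 1 | 4 ≤ x 0 ∧ x 0 ≤ 31} := by
  ext x
  rw [lamT, (regions_ex).1]
  simp only [enl, Set.mem_setOf_eq]
  constructor
  · rintro ⟨y, ⟨hy1, hy2⟩, hn⟩
    have h := (idxNear_one_iff 1 x y).1 hn
    rw [abs_le] at h
    push_cast at h
    constructor <;> linarith [h.1, h.2]
  · rintro ⟨h1, h2⟩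
    refine ⟨pt (max (x 0) 5 - if x 0 = 31 then 1 else 0), ?_, (idxNear_one_iff 1 x _).2 ?_⟩
    · simp only [pt]
      split_ifs with h <;> constructor <;>
        first | linarith [le_max_left (x 0) 5, le_max_right (x 0) 5] | omega
    · simp only [pt]
      rw [abs_le]
      push_cast
      rcases le_total (x 0) 5 with h5 | h5
      · rw [max_eq_right h5]
        split_ifs with h <;> constructor <;> linarith
      · rw [max_eq_left h5]
        split_ifs with h <;> constructor <;> linarith

/-- The top clause of the example is `[1, 5]`; its part outside the pattern `Λ~` (t = 1) is `[1, 3]` (three clear layers)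
and its part inside is `[4, 5]`. [folklore] -/
theorem top_split_ex :
    Zex ∩ (enl 1 5 Ωex \ Ωex) = {x : Pt 1 | 1 ≤ x 0 ∧ x 0 ≤ 5} ∧
      (Zex ∩ (enl 1 5 Ωex \ Ωex)) \ lamZ 1 1 Ωex Zex = {x : Pt 1 | 1 ≤ x 0 ∧ x 0 ≤ 3} ∧
      (Zex ∩ (enl 1 5 Ωex \ Ωex)) ∩ lamZ 1 1 Ωex Zex = {x : Pt 1 | 4 ≤ x 0 ∧ x 0 ≤ 5} := by
  have htop : Zex ∩ (enl 1 5 Ωex \ Ωex) = {x : Pt 1 | 1 ≤ x 0 ∧ x 0 ≤ 5} := by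
    ext x
    rw [enl_Ωex]
    simp only [Zex, Ωex, Set.mem_inter_iff, Set.mem_sdiff, Set.mem_setOf_eq, not_le]
    push_cast
    omega
  refine ⟨htop, ?_, ?_⟩
  · rw [top_diff_lamZ 1 1 (by norm_num), enl_Ωex]
    ext x
    simp only [Zex, Ωex, Set.mem_inter_iff, Set.mem_sdiff, Set.mem_setOf_eq, not_le]
    push_cast
    omega
  · rw [top_inter_lamZ 1 1, enl_Ωex, enl_Ωex]
    ext x
    simp only [Zex, Set.mem_inter_iff, Set.mem_sdiff, Set.mem_setOf_eq, not_le]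
    push_cast
    omega

/-- A pinched large-field region, `Z♯ = {5} ∪ [7, 30]`, same `Ω`: here `Λ = {5} ∪ [7,30]` but `Z″_k = [7, 30]`, and the
point 5 of `Λ` is NOT within one layer of `Z″_k` — the gloss *"obtained by adding one layer of M-cubes to Z″_k"* read as
`Λ = (Z″_k)~ ∩ Z` would be FALSE; the display (1.73) is the definition (for the parallelepipeds the print works with, the
two agree). [folklore] -/
theorem not_Lam_subset_enl_Zk :
    ¬ (Lam 1 Ωex ({x : Pt 1 | x 0 = 5 ∨ (7 ≤ x 0 ∧ x 0 ≤ 30)}) ⊆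
        enl 1 1 (Zk 1 Ωex {x : Pt 1 | x 0 = 5 ∨ (7 ≤ x 0 ∧ x 0 ≤ 30)})) := by
  intro h
  have h5 : pt 5 ∈ Lam 1 Ωex {x : Pt 1 | x 0 = 5 ∨ (7 ≤ x 0 ∧ x 0 ≤ 30)} := by
    refine ⟨?_, Or.inl rfl⟩
    rw [enl_Ωex]
    simp [pt]
  obtain ⟨y, ⟨hy5, hyZ⟩, hn⟩ := h h5
  rw [enl_Ωex] at hy5
  simp only [Set.mem_compl_iff, Set.mem_setOf_eq, not_le] at hy5
  have h1 := (idxNear_one_iff 1 (pt 5) y).1 hn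
  rw [abs_le] at h1
  simp only [pt] at h1
  push_cast at h1 hy5
  rcases hyZ with hy | ⟨hy7, -⟩
  · rw [hy] at hy5; omega
  · linarith [h1.1, h1.2]

end OneDim

/-! ## H. The localization domain `X₀ = Z ∩ Ω″~_{h+1}` of [II] p. 362 and the constraint region `Z ∖ Λ` of [II] (1.3)–(1.4)
(v1.2).  Pure set algebra on the typed regions of §§B–D; `Ω` = `Ω_{k₀+1}`, `Ωk`/`Ω'` = the old domain entering (1.12) on the
`Zᶜ`-side (irrelevant on the `Z`-side), `Zpp` = any core `Z″_j`. -/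

/-- **`Z ∖ Λ` lies in the top-level zone of the new sequence:** `Z ∖ Λ ⊆ Ω″_k ∩ Z`, from (1.73) `Z ∖ Λ = Z ∩ Ω~⁴` and
(1.10), (1.12) `Ω″_k ∩ Z = Z ∩ Ω~⁵`.  (The region on which [II] (1.3)/(1.4) prescribe the averages is one where the new
determining set of [IV] (1.12) carries the level k only.) [folklore] -/
theorem diff_Lam_subset_omegaPP_Zk (s : ℕ) (Ω Ωk Z : Set (Pt d)) :
    Z \ Lam s Ω Z ⊆ OmegaPP (Zk s Ω Z) Ωk Z ∩ Z := by
  rw [diff_Lam_eq, omegaPP_Zk_inter_Z]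
  exact fun _ hx => ⟨enl_mono_layers s (by norm_num) Ω hx.2, hx.1⟩

/-- **Every new domain whose core lies inside `Z″_k` contains `Z ∖ Λ` on the Z-side:** for `Z″ ⊆ Z″_k` (all the regions
`Z″_j`, j ≤ k, of the printed completion (1.10)–(1.11)), `Z ∖ Λ ⊆ Ω″(Z″) ∩ Z`.  In particular the p. 362 localization
domain `X₀ = Z ∩ Ω″~_{h+1} ⊇ Z ∩ Ω″_{h+1}` CONTAINS `Z ∖ Λ` — the region of the condition (1.4) invoked on p. 364.
[folklore] -/
theorem diff_Lam_subset_omegaPP (s : ℕ) {Ω Z Zpp : Set (Pt d)} (Ω' : Set (Pt d)) (h : Zpp ⊆ Zk s Ω Z) :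
    Z \ Lam s Ω Z ⊆ OmegaPP Zpp Ω' Z ∩ Z := by
  rw [omegaPP_inter_Z]
  exact fun _ hx => ⟨fun hZ => hx.2 (Zk_subset_Lam s Ω Z (h hZ)), hx.1⟩

/-- **The `4 − t` M-layers next to `Ω_{k₀+1}` inside `Z` lie in `Z ∖ Λ` and off the literal `Λ~`** (`t ≤ 4`):
`Z ∩ Ω~⁽⁴⁻ᵗ⁾ ⊆ (Z ∖ Λ) ∖ Λ~`. [folklore] -/
theorem inner_layers_subset_diff_Lam_diff_lamT (s t : ℕ) (ht : t ≤ 4) (Ω Z : Set (Pt d)) :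
    Z ∩ enl s (4 - t) Ω ⊆ (Z \ Lam s Ω Z) \ lamT s t Ω Z := by
  intro x hx
  refine ⟨?_, fun h => lamT_subset_compl_enl s t ht Ω Z h hx.2⟩
  rw [diff_Lam_eq]
  exact ⟨hx.1, enl_mono_layers s (by omega) Ω hx.2⟩

/-- … and off the pattern `Λ~` as well (any `t`): `Z ∩ Ω~⁽⁴⁻ᵗ⁾ ⊆ (Z ∖ Λ) ∖ lamZ`. [folklore] -/
theorem inner_layers_subset_diff_Lam_diff_lamZ (s t : ℕ) (Ω Z : Set (Pt d)) :
    Z ∩ enl s (4 - t) Ω ⊆ (Z \ Lam s Ω Z) \ lamZ s t Ω Z := by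
  intro x hx
  refine ⟨?_, fun (h : x ∈ farZ s (4 - t) Ω Z) => (farZ_subset_compl_enl s (4 - t) Ω Z h) hx.2⟩
  rw [diff_Lam_eq]
  exact ⟨hx.1, enl_mono_layers s (by omega) Ω hx.2⟩

/-- **Hence no superset of `Ω″(Z″) ∩ Z` — e.g. `X₀ = Z ∩ Ω″~_{h+1}` or its thickening `X̃₀⁵` — is contained in the
literal `Λ~`** (`t ≤ 4`), as soon as `Z` meets `Ω~⁽⁴⁻ᵗ⁾` (in print `Z` meets `Ω_{k₀+1}` itself: the regions *"connected
with the last N steps"* of [IV] p. 177).  Cell row C-adv3-90, menu (q), answered in the negative. [folklore] -/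
theorem not_subset_lamT_of_supset (s t : ℕ) (ht : t ≤ 4) {Ω Ω' Z Zpp X0 : Set (Pt d)} (h : Zpp ⊆ Zk s Ω Z)
    (hX : OmegaPP Zpp Ω' Z ∩ Z ⊆ X0) (hne : (Z ∩ enl s (4 - t) Ω).Nonempty) : ¬ X0 ⊆ lamT s t Ω Z := by
  rintro hsub
  obtain ⟨x, hx⟩ := hne
  have h1 := inner_layers_subset_diff_Lam_diff_lamT s t ht Ω Z hx
  exact h1.2 (hsub (hX (diff_Lam_subset_omegaPP s Ω' h h1.1)))

/-- … nor in the pattern `Λ~` (any `t`). [folklore] -/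
theorem not_subset_lamZ_of_supset (s t : ℕ) {Ω Ω' Z Zpp X0 : Set (Pt d)} (h : Zpp ⊆ Zk s Ω Z)
    (hX : OmegaPP Zpp Ω' Z ∩ Z ⊆ X0) (hne : (Z ∩ enl s (4 - t) Ω).Nonempty) : ¬ X0 ⊆ lamZ s t Ω Z := by
  rintro hsub
  obtain ⟨x, hx⟩ := hne
  have h1 := inner_layers_subset_diff_Lam_diff_lamZ s t Ω Z hx
  exact h1.2 (hsub (hX (diff_Lam_subset_omegaPP s Ω' h h1.1)))

namespace OneDim

/-- In the `d = 1` configuration of §G (`Ω = {x ≤ 0}`, `Z = [-3, 30]`, `Λ = [5, 30]`, literal `Λ~` (t = 1) `= [4, 31]`), with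
the core `Z″ = farZ 1 20 Ω Z = [21, 30] ⊆ Z″_k = [6, 30]`: the Z-side of the new domain `Ω″(Z″)` is `[-3, 20]`; it contains
`Z ∖ Λ = [-3, 4]`, and the point `0 ∈ Ω ∩ Z` lies in it but not in `Λ~` — for every choice of the `Zᶜ`-side domain `Ω'`.
[folklore] -/
theorem X0_ex_not_subset_lamT (Ω' : Set (Pt 1)) :
    ¬ (OmegaPP (farZ 1 20 Ωex Zex) Ω' Zex ∩ Zex ⊆ lamT 1 1 Ωex Zex) := by
  have hne : (Zex ∩ enl 1 (4 - 1) Ωex).Nonempty := by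
    refine ⟨pt 0, ?_, ?_⟩
    · simp [Zex, pt]
    · rw [enl_Ωex]
      simp [pt]
  exact not_subset_lamT_of_supset 1 1 (by norm_num) (farZ_antitone 1 (by norm_num : (5 : ℕ) ≤ 20) Ωex Zex)
    subset_rfl hne

end OneDim

/-! ### H′ (v1.3). The excluded set of the retyped decoration set σ₀′ (cell row C-adv3-91) covers the whole component.
For every set `X₀` squeezed between the Z-side of a new domain and `Z` — `Ω″(Z″) ∩ Z ⊆ X₀ ⊆ Z`, core `Z″ ⊆ Z″_k` — one
has `Λ ∪ X₀ = Z`; hence `Λ~ ∪ X₀ = Z` for the pattern `Λ~ ⊆ Z` and `Z ⊆ Λ~ ∪ X₀` for the literal `Λ~`.  So a cube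
disjoint with `□₀ ∪ Λ~ ∪ X̃₀⁵` is in particular disjoint with `Z`: on the component, σ₀′ decorates nothing. -/

/-- **`Λ ∪ X₀ = Z`.**  With `Z″ ⊆ Z″_k ⊆ Λ` (`Zk_subset_Lam`) and `Z ∖ Z″ = Ω″(Z″) ∩ Z ⊆ X₀ ⊆ Z`. [folklore] -/
theorem Lam_union_eq_of_supset (s : ℕ) {Ω Ω' Z Zpp X0 : Set (Pt d)} (h : Zpp ⊆ Zk s Ω Z)
    (hX : OmegaPP Zpp Ω' Z ∩ Z ⊆ X0) (hX' : X0 ⊆ Z) : Lam s Ω Z ∪ X0 = Z := by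
  refine Set.Subset.antisymm (Set.union_subset (Lam_subset_Z s Ω Z) hX') fun x hx => ?_
  by_cases hZ : x ∈ Zpp
  · exact Or.inl (Zk_subset_Lam s Ω Z (h hZ))
  · refine Or.inr (hX ?_)
    rw [omegaPP_inter_Z]
    exact ⟨hZ, hx⟩

/-- **Pattern reading:** `Λ~ ∪ X₀ = Z` (any `t`; `lamZ ⊆ Z`). [folklore] -/
theorem lamZ_union_eq_of_supset (s t : ℕ) {Ω Ω' Z Zpp X0 : Set (Pt d)} (h : Zpp ⊆ Zk s Ω Z)
    (hX : OmegaPP Zpp Ω' Z ∩ Z ⊆ X0) (hX' : X0 ⊆ Z) : lamZ s t Ω Z ∪ X0 = Z := by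
  refine Set.Subset.antisymm (Set.union_subset (fun x hx => (lamZ_subset s t Ω Z hx).2) hX') fun x hx => ?_
  rcases (Lam_union_eq_of_supset s h hX hX').symm.subset hx with hL | hX0
  · exact Or.inl (Lam_subset_lamZ s t Ω Z hL)
  · exact Or.inr hX0

/-- **Literal reading:** `Z ⊆ Λ~ ∪ X₀` (the literal `Λ~` may leave `Z`, so only this inclusion). [folklore] -/
theorem subset_lamT_union_of_supset (s t : ℕ) {Ω Ω' Z Zpp X0 : Set (Pt d)} (h : Zpp ⊆ Zk s Ω Z)
    (hX : OmegaPP Zpp Ω' Z ∩ Z ⊆ X0) (hX' : X0 ⊆ Z) : Z ⊆ lamT s t Ω Z ∪ X0 := by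
  intro x hx
  rcases (Lam_union_eq_of_supset s h hX hX').symm.subset hx with hL | hX0
  · exact Or.inl (Lam_subset_lamT s t Ω Z hL)
  · exact Or.inr hX0

/-- **Hence a set disjoint with `Λ~ ∪ X₀` (either reading, any further enlargement of `X₀` inside `Z`) is disjoint with
the component `Z`:** the retyped decoration set σ₀′ of cell row C-adv3-91 contains no cube meeting `Z`. [folklore] -/
theorem disjoint_Z_of_disjoint_union {Z E Δ : Set (Pt d)} (hZE : Z ⊆ E) (hΔ : Disjoint Δ E) : Disjoint Δ Z :=
  hΔ.mono_right hZE

end Literature.MathematicalPhysics.QuantumFieldTheory.Balaban1983to89.B16Stage3Regions
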